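import Summits.RiemannHypothesis.RiemannHypothesis.Theses.SignCone
import Summits.RiemannHypothesis.RiemannHypothesis.Theorems.SignConeSignConeOscillatoryRouteCorollaries
import Literature.NumberTheory.LFunctions.WeilGroundEnergyProofs

/-!
# `SignCone.ConeMagnification` (crux stmt-RiemannHypothesis-16303): load-bearing map and
# refuted strengthenings (negative-side support, cdisprove cycle 1)

Support file of the crux disprover (seat `refuter-cdisprove-stmt-RiemannHypothesis-16303-0`);
companion of the crux workfile `Cruxes/ConeMagnification/Disproof.lean`. No definitions: below,
`Hyp` means the VERBATIM antecedent of `ConeMagnification` (at every cutoff `a > 0` a weight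
`c ≥ 0`, `c 1 = 0`, whose fake Weil form `W_ar - P_c` has unit slack on the Weil tests supported in
`[-a, a]`), `Dual a` its instance at one cutoff, and "`c` is in the uniform unit-slack cone" the same
inequality for ALL Weil tests. All statements are spelled out inline (long lines = item text) and are
definitionally the Literature forms (`IsWeilTest`, `weilConv g (weilReflect g)`, `weilPolarTerm`,
`weilArchTerm`, `weilPrimeTerm`; route file CONE NOTE), which the proofs `show`.

The crux is `Hyp → RH`. Findings, all sorry-free:

* `coneMagnification_not_iff` — `¬ ConeMagnification ↔ Hyp ∧ ¬ RH` (logic), and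
  `coneMagnification_hyp_of_riemannHypothesis` — `RH → Hyp` (`c = Λ`: explicit formula + easy half
  of Weil's criterion, in-tree). Hence ANY refutation of this crux contains a disproof of RH; no
  `_false_without_` theorem can exist for it, and
  (given the proved sibling crux `SignConeDuality`) `coneMagnification_not_iff_signConeInequality`:
  `¬ ConeMagnification ↔ SignConeInequality ∧ ¬ RH` — the crux fails exactly if the route's target is
  true while the summit is false.
* `coneMagnification_dual_of_le_certb` — `Dual a` holds UNCONDITIONALLY for every `a ≤ 563/1024`
  (one weight for all of them: `c = log 2 · 𝟙{n = 2}`, slack `0`; the fake form is then the tree's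
  certified first-prime form `E₂ ≥ 0`, `weilCert3C`). So the quantifier over ALL cutoffs is
  load-bearing: `coneMagnification_boundedCutoff_iff_riemannHypothesis` — the crux restricted to
  cutoffs `a ≤ 563/1024` is equivalent to the summit itself.
* `coneMagnification_dualSlack` — with a CUTOFF-DEPENDENT slack `C(a) ‖g‖₂²`
  (`C(a) = 2(sinh a - a) + 2 Σ_{n ≤ e^{2a}} Λ(n)/√n - ψ(1/4) + log π`, Bombieri 2000 §4) the
  inequality holds unconditionally at every cutoff with `c = Λ` (in-tree
  `weilQuadratic_re_ge_of_tsupport_subset`). So the UNIFORMITY of the unit slack in `a` is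
  load-bearing: `coneMagnification_cutoffSlack_iff_riemannHypothesis` — the crux with `∃ C` inside
  the cutoff quantifier is equivalent to the summit itself.
* Refuted natural strengthenings of the magnification step (the 2001 W-MAG plan proves RH from ONE
  weight in the uniform cone via a deficit bound and a Landau transfer): under RH the uniform
  unit-slack cone is NOT rigid and its prime deficit reaches `1/2` —
  `coneMagnification_slackCone_sub_single_of_riemannHypothesis`: for every `p` and `0 ≤ η ≤ √p/2` the
  weight `Λ - η 𝟙{n = p}` is in the uniform cone (`|G| ≤ G(0) = ‖g‖₂²`, Bombieri's Lemma 2);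
  `coneMagnification_not_slackConeRigid_of_riemannHypothesis`: the weight `Λ 𝟙{n ≠ 2}` (the prime `2`
  DELETED) is in the cone, so "cone member ⇒ `c = Λ`" (true for slack `0`, 2001 W-COMP/W-SRPP) is false
  with unit slack; `coneMagnification_exists_slackCone_deficit_eq_half_of_riemannHypothesis`: the weight
  `Λ - (√7/2) 𝟙{n = 7}` is in the cone with `Σₙ (Λ(n) - c(n))₊/√n = 1/2`, so no deficit lemma with a
  constant `< 1/2` can hold (heuristically `1/2` is sharp for prime-supported deficits: Kronecker at
  large heights; see `Disproof.lean` §C).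
-/

noncomputable section

-- `Summit.RiemannHypothesis.RiemannHypothesis.…` repeats a namespace component by design (D-0017 layout).
set_option linter.dupNamespace false

open scoped BigOperators ArithmeticFunction.vonMangoldt ComplexConjugate
open MeasureTheory Set Literature.NumberTheory.LFunctions
open Summit.RiemannHypothesis.RiemannHypothesis.Theses.SignCone
open Summit.RiemannHypothesis.RiemannHypothesis.Theorems.SignCone

namespace Summit.RiemannHypothesis.RiemannHypothesis.Theorems.ConeMagnification.Negative

/-! ## A. Irrefutability: `¬ ConeMagnification ↔ Hyp ∧ ¬ RH`, and `RH → Hyp` -/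

/-- **The shape of a refutation.** `ConeMagnification` is literally `Hyp → RH`, so its negation is
`Hyp ∧ ¬ RH` (`Hyp` verbatim). [folklore] -/
theorem coneMagnification_not_iff :
    ¬ ConeMagnification ↔
      ((∀ a : ℝ, 0 < a → ∃ c : ℕ → ℝ, (∀ n, 0 ≤ c n) ∧ c 1 = 0 ∧ ∀ g : ℝ → ℂ, (ContDiff ℝ ((⊤ : ℕ∞) : WithTop ℕ∞) g ∧ HasCompactSupport g) → tsupport g ⊆ Set.Icc (-a) a → let G : ℝ → ℂ := MeasureTheory.convolution g (fun u => (starRingEnd ℂ) (g (-u))) (ContinuousLinearMap.mul ℂ ℂ) MeasureTheory.MeasureSpace.volume; let M : ℂ → ℂ := fun s => ∫ u : ℝ, G u * Complex.exp ((s - 1 / 2) * u); -(∫ t, ‖g t‖ ^ 2) ≤ (M 0 + M 1 + ((1 / (2 * Real.pi) : ℂ) * (∫ t : ℝ, M (1 / 2 + t * Complex.I) * ((Complex.digamma (1 / 4 + t / 2 * Complex.I)).re : ℂ)) - G 0 * (Real.log Real.pi : ℂ)) - ∑' n : ℕ, ((c n : ℝ) : ℂ) / (Real.sqrt n : ℂ)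 * (G (Real.log n) + G (-Real.log n))).re) ∧
        ¬ Summit.RiemannHypothesis) := by
  unfold ConeMagnification
  exact Classical.not_imp

/-- **`RH → Hyp`**, at every cutoff, with the TRUE weight `c = Λ` (`Λ ≥ 0`, `Λ 1 = 0`): the item's
fake Weil form at `c = Λ` is definitionally `weilQuadratic g`, which is `≥ 0 ≥ -‖g‖₂²` under RH
(`WeilPositivity.of_riemannHypothesis explicit_formula_holds`, in-tree). [folklore] -/
theorem coneMagnification_hyp_of_riemannHypothesis (hRH : Summit.RiemannHypothesis) :
    ∀ a : ℝ, 0 < a → ∃ c : ℕ → ℝ, (∀ n, 0 ≤ c n) ∧ c 1 = 0 ∧ ∀ g : ℝ → ℂ, (ContDiff ℝ ((⊤ : ℕ∞) : WithTop ℕ∞) g ∧ HasCompactSupport g) → tsupport g ⊆ Set.Icc (-a) a → let G : ℝ → ℂ := MeasureTheory.convolution g (fun u => (starRingEnd ℂ) (g (-u))) (ContinuousLinearMap.mul ℂ ℂ) MeasureTheory.MeasureSpace.volume; let M : ℂ → ℂ := fun s => ∫ u : ℝ, G u * Complex.exp ((s - 1 / 2) * u); -(∫ t, ‖g t‖ ^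 2) ≤ (M 0 + M 1 + ((1 / (2 * Real.pi) : ℂ) * (∫ t : ℝ, M (1 / 2 + t * Complex.I) * ((Complex.digamma (1 / 4 + t / 2 * Complex.I)).re : ℂ)) - G 0 * (Real.log Real.pi : ℂ)) - ∑' n : ℕ, ((c n : ℝ) : ℂ) / (Real.sqrt n : ℂ) * (G (Real.log n) + G (-Real.log n))).re := by
  intro a _
  refine ⟨fun n => Λ n, fun _ => ArithmeticFunction.vonMangoldt_nonneg,
    by simp [ArithmeticFunction.vonMangoldt_apply_one], ?_⟩
  intro g hg _
  have hW : 0 ≤ (weilQuadratic g).re :=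
    WeilPositivity.of_riemannHypothesis explicit_formula_holds hRH g hg
  have hN : 0 ≤ ∫ t : ℝ, ‖g t‖ ^ 2 := integral_nonneg fun _ => by positivity
  show -(∫ t : ℝ, ‖g t‖ ^ 2) ≤
    (weilPolarTerm (weilConv g (weilReflect g)) + weilArchTerm (weilConv g (weilReflect g)) -
      weilPrimeTerm (weilConv g (weilReflect g))).re
  have hQ : weilPolarTerm (weilConv g (weilReflect g)) + weilArchTerm (weilConv g (weilReflect g)) -
      weilPrimeTerm (weilConv g (weilReflect g)) = weilQuadratic g := by
    simp only [weilQuadratic, weilFunctional]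
    ring
  rw [hQ]
  linarith

/-- **Given the (proved) duality crux, the crux fails exactly if the route's target holds while the
summit fails**: `¬ ConeMagnification ↔ SignConeInequality ∧ ¬ RH` (`Hyp → SignConeInequality` is the
easy converse `signConeInequality_of_coneMagnificationHyp`; `SignConeInequality → Hyp` is
`SignConeDuality`, in-tree as `SignConeDuality_of`, passed here as a hypothesis only because its
module cannot be co-imported with this one). [folklore] -/
theorem coneMagnification_not_iff_signConeInequality (hD : SignConeDuality) :
    ¬ ConeMagnification ↔ (SignConeInequality ∧ ¬ Summit.RiemannHypothesis) := by
  rw [coneMagnification_not_iff]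
  constructor
  · rintro ⟨hHyp, hnRH⟩
    exact ⟨signConeInequality_of_coneMagnificationHyp hHyp, hnRH⟩
  · rintro ⟨hX, hnRH⟩
    exact ⟨fun a ha => hD a ha (hX a ha), hnRH⟩

/-! ## B. The quantifier over ALL cutoffs is load-bearing: `Dual a` is a theorem for `a ≤ 563/1024` -/

/-- **Unconditional at bounded cutoffs, with one weight.** For every `a ≤ 563/1024` the conclusion
`Dual a` holds with the weight `c = log 2 · 𝟙{n = 2}` and slack `0`: for a Weil test `g` supported in
`[-a, a]`, `W_ar(g ⋆ g̃) - (log 2/√2)((g ⋆ g̃)(log 2) + (g ⋆ g̃)(-log 2)) = E₂(g)`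
(`weilArchPolar_weilConv_weilReflect_eq`) and `E₂(g) ≥ 0` is the tree's kernel-checked first-prime
certificate at support `563/1024` (`weilFirstPrimeQuadratic_nonneg_of_tsupport_subset_certb`). [folklore] -/
theorem coneMagnification_dual_of_le_certb :
    ∀ a : ℝ, a ≤ 563 / 1024 → ∃ c : ℕ → ℝ, (∀ n, 0 ≤ c n) ∧ c 1 = 0 ∧ ∀ g : ℝ → ℂ, (ContDiff ℝ ((⊤ : ℕ∞) : WithTop ℕ∞) g ∧ HasCompactSupport g) → tsupport g ⊆ Set.Icc (-a) a → let G : ℝ → ℂ := MeasureTheory.convolution g (fun u => (starRingEnd ℂ) (g (-u))) (ContinuousLinearMap.mul ℂ ℂ) MeasureTheory.MeasureSpace.volume; let M : ℂ → ℂ := fun s => ∫ u : ℝ, G u * Complex.exp ((s - 1 / 2) * u); -(∫ t, ‖g t‖ ^ 2) ≤ (M 0 + M 1 + ((1 / (2 * Real.pi) : ℂ) * (∫ t : ℝ, M (1 / 2 + t * Complex.I) * ((Complex.digamma (1 / 4 + t / 2 * Complex.I)).re : ℂ)) - G 0 * (Real.log Real.pi : ℂ)) - ∑' n : ℕ, ((c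 n : ℝ) : ℂ) / (Real.sqrt n : ℂ) * (G (Real.log n) + G (-Real.log n))).re := by
  intro a ha
  refine ⟨fun n => if n = 2 then Real.log 2 else 0, fun n => ?_, by norm_num, ?_⟩
  · by_cases h : n = 2
    · simp only [h, if_true]
      exact Real.log_nonneg (by norm_num)
    · simp [h]
  · intro g hg hsupp
    have hg' : IsWeilTest g := hg
    have hs : tsupport g ⊆ Icc (-(563 / 1024 : ℝ)) (563 / 1024) :=
      hsupp.trans (Icc_subset_Icc (by linarith) ha)
    have hE : 0 ≤ weilFirstPrimeQuadratic g :=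
      weilFirstPrimeQuadratic_nonneg_of_tsupport_subset_certb hg' hs
    have hN : 0 ≤ ∫ t : ℝ, ‖g t‖ ^ 2 := integral_nonneg fun _ => by positivity
    show -(∫ t : ℝ, ‖g t‖ ^ 2) ≤
      (weilPolarTerm (weilConv g (weilReflect g)) + weilArchTerm (weilConv g (weilReflect g)) -
        ∑' n : ℕ, (((if n = 2 then Real.log 2 else 0 : ℝ) : ℝ) : ℂ) / (Real.sqrt n : ℂ) *
          (weilConv g (weilReflect g) (Real.log n) + weilConv g (weilReflect g) (-Real.log n))).re
    have htsum : (∑' n : ℕ, (((if n = 2 then Real.log 2 else 0 : ℝ) : ℝ) : ℂ) / (Real.sqrt n : ℂ) *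
          (weilConv g (weilReflect g) (Real.log n) + weilConv g (weilReflect g) (-Real.log n))) =
        ((Real.log 2 : ℝ) : ℂ) / (Real.sqrt 2 : ℂ) *
          (weilConv g (weilReflect g) (Real.log 2) + weilConv g (weilReflect g) (-Real.log 2)) := by
      rw [tsum_eq_single 2]
      · simp
      · intro n hn
        simp [hn]
    rw [htsum, weilArchPolar_weilConv_weilReflect_eq hg', add_sub_cancel_right, Complex.ofReal_re]
    linarith

/-- **The crux restricted to bounded cutoffs is the summit.** Replacing "every cutoff `a > 0`" by
"every cutoff `0 < a ≤ 563/1024`" in the antecedent of `ConeMagnification` gives a statement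
EQUIVALENT to `RiemannHypothesis` (its antecedent being a theorem, `coneMagnification_dual_of_le_certb`):
any proof of the crux must use arbitrarily large cutoffs. [folklore] -/
theorem coneMagnification_boundedCutoff_iff_riemannHypothesis :
    ((∀ a : ℝ, 0 < a → a ≤ 563 / 1024 → ∃ c : ℕ → ℝ, (∀ n, 0 ≤ c n) ∧ c 1 = 0 ∧ ∀ g : ℝ → ℂ, (ContDiff ℝ ((⊤ : ℕ∞) : WithTop ℕ∞) g ∧ HasCompactSupport g) → tsupport g ⊆ Set.Icc (-a) a → let G : ℝ → ℂ := MeasureTheory.convolution g (fun u => (starRingEnd ℂ) (g (-u))) (ContinuousLinearMap.mul ℂ ℂ) MeasureTheory.MeasureSpace.volume; let M : ℂ → ℂ := fun s => ∫ u : ℝ, G u * Complex.exp ((s - 1 / 2) * u); -(∫ t, ‖g t‖ ^ 2) ≤ (M 0 + M 1 + ((1 / (2 * Real.pi) : ℂ) * (∫ t : ℝ, M (1 / 2 + t * Complex.I) * ((Complex.digamma (1 / 4 + t / 2 * Complex.I)).re : ℂ)) - G 0 * (Real.log Real.pi : ℂ)) - ∑' n : ℕ, ((c n : ℝ) : ℂ)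 / (Real.sqrt n : ℂ) * (G (Real.log n) + G (-Real.log n))).re) →
        Summit.RiemannHypothesis) ↔
      Summit.RiemannHypothesis :=
  ⟨fun h => h fun a _ ha => coneMagnification_dual_of_le_certb a ha, fun hRH _ => hRH⟩

/-! ## C. The uniformity of the unit slack is load-bearing: cutoff-dependent slack is free -/

/-- **Cutoff-dependent slack, unconditionally, with `c = Λ`.** For every real `a` and every Weil
test `g` supported in `[-a, a]`,
`-(2(sinh a - a) + 2 Σ_{n ≤ e^{2a}} Λ(n)/√n - (Re ψ(1/4) - log π)) ‖g‖₂² ≤ Re (W_ar(g ⋆ g̃) - P_Λ(g ⋆ g̃))`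
— the item's inequality with the unit slack replaced by Bombieri's a-priori constant (Bombieri 2000
§4 Lemma 3 / Thm 3, in-tree `weilQuadratic_re_ge_of_tsupport_subset`; no RH). [folklore] -/
theorem coneMagnification_dualSlack (a : ℝ) :
    ∀ g : ℝ → ℂ, (ContDiff ℝ ((⊤ : ℕ∞) : WithTop ℕ∞) g ∧ HasCompactSupport g) → tsupport g ⊆ Set.Icc (-a) a → let G : ℝ → ℂ := MeasureTheory.convolution g (fun u => (starRingEnd ℂ) (g (-u))) (ContinuousLinearMap.mul ℂ ℂ) MeasureTheory.MeasureSpace.volume; let M : ℂ → ℂ := fun s => ∫ u : ℝ, G u * Complex.exp ((s - 1 / 2) * u); -((2 * (Real.sinh a - a) + 2 * (∑ n ∈ Finset.range (⌊Real.exp (2 * a)⌋₊ + 1), (Λ n : ℝ) / Real.sqrt n) - ((Complex.digamma (1 / 4)).re - Real.log Real.pi)) * ∫ t, ‖g t‖ ^ 2) ≤ (M 0 + M 1 + ((1 / (2 * Real.pi) : ℂ) * (∫ t : ℝ, M (1 / 2 + t * Complex.I) * ((Complex.digamma (1 / 4 + t / 2 * Complex.I)).re : ℂ)) - G 0 * (Real.log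 Real.pi : ℂ)) - ∑' n : ℕ, ((Λ n : ℝ) : ℂ) / (Real.sqrt n : ℂ) * (G (Real.log n) + G (-Real.log n))).re := by
  intro g hg hsupp
  have h := weilQuadratic_re_ge_of_tsupport_subset (g := g) hg hsupp
  show _ ≤ (weilPolarTerm (weilConv g (weilReflect g)) + weilArchTerm (weilConv g (weilReflect g)) -
      weilPrimeTerm (weilConv g (weilReflect g))).re
  have hQ : weilPolarTerm (weilConv g (weilReflect g)) + weilArchTerm (weilConv g (weilReflect g)) -
      weilPrimeTerm (weilConv g (weilReflect g)) = weilQuadratic g := by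
    simp only [weilQuadratic, weilFunctional]
    ring
  rw [hQ]
  linarith

/-- **The crux with cutoff-dependent slack is the summit.** Moving an `∃ C` inside the cutoff
quantifier of the antecedent (slack `-C ‖g‖₂²` in place of `-‖g‖₂²`) gives a statement EQUIVALENT to
`RiemannHypothesis`: its antecedent is a theorem (`coneMagnification_dualSlack`, `c = Λ`). So the
content of the crux sits in the uniformity of the slack constant across cutoffs. [folklore] -/
theorem coneMagnification_cutoffSlack_iff_riemannHypothesis :
    ((∀ a : ℝ, 0 < a → ∃ C : ℝ, ∃ c : ℕ → ℝ, (∀ n, 0 ≤ c n) ∧ c 1 = 0 ∧ ∀ g : ℝ → ℂ, (ContDiff ℝ ((⊤ : ℕ∞) : WithTop ℕ∞) g ∧ HasCompactSupport g) → tsupport g ⊆ Set.Icc (-a) a → let G : ℝ → ℂ := MeasureTheory.convolution g (fun u => (starRingEnd ℂ) (g (-u))) (ContinuousLinearMap.mul ℂ ℂ) MeasureTheory.MeasureSpace.volume; let M : ℂ → ℂ := fun s => ∫ u : ℝ, G u * Complex.exp ((s - 1 / 2) * u); -(C * ∫ t, ‖g t‖ ^ 2) ≤ (M 0 + M 1 +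 ((1 / (2 * Real.pi) : ℂ) * (∫ t : ℝ, M (1 / 2 + t * Complex.I) * ((Complex.digamma (1 / 4 + t / 2 * Complex.I)).re : ℂ)) - G 0 * (Real.log Real.pi : ℂ)) - ∑' n : ℕ, ((c n : ℝ) : ℂ) / (Real.sqrt n : ℂ) * (G (Real.log n) + G (-Real.log n))).re) →
        Summit.RiemannHypothesis) ↔
      Summit.RiemannHypothesis := by
  refine ⟨fun h => h fun a _ => ?_, fun hRH _ => hRH⟩
  exact ⟨2 * (Real.sinh a - a) + 2 * (∑ n ∈ Finset.range (⌊Real.exp (2 * a)⌋₊ + 1), (Λ n : ℝ) / Real.sqrt n) -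
      ((Complex.digamma (1 / 4)).re - Real.log Real.pi),
    fun n => Λ n, fun _ => ArithmeticFunction.vonMangoldt_nonneg,
    by simp [ArithmeticFunction.vonMangoldt_apply_one], coneMagnification_dualSlack a⟩

/-! ## D. Refuted strengthenings of the magnification step: the unit-slack cone under RH -/

/-- **Single-prime deletions stay in the uniform unit-slack cone (under RH).** For every `p : ℕ` and
`0 ≤ η` with `2η ≤ √p`, the weight `c = Λ - η 𝟙{n = p}` satisfies the unit-slack inequality against
EVERY Weil test `g` (no support restriction): the fake form is `Q(g) + (η/√p)(G(log p) + G(-log p))`,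
`G = g ⋆ g̃`, with `Re Q(g) ≥ 0` under RH and `|G(± log p)| ≤ ‖g‖₂²` (Bombieri 2000 §4 Lemma 2, in-tree
`norm_weilConv_weilReflect_le`), so the correction is `≥ -(2η/√p) ‖g‖₂² ≥ -‖g‖₂²`. [folklore] -/
theorem coneMagnification_slackCone_sub_single_of_riemannHypothesis (hRH : Summit.RiemannHypothesis)
    {p : ℕ} {η : ℝ} (hη : 0 ≤ η) (hηp : 2 * η ≤ Real.sqrt p) :
    ∀ g : ℝ → ℂ, (ContDiff ℝ ((⊤ : ℕ∞) : WithTop ℕ∞) g ∧ HasCompactSupport g) → let G : ℝ → ℂ := MeasureTheory.convolution g (fun u => (starRingEnd ℂ) (g (-u))) (ContinuousLinearMap.mul ℂ ℂ) MeasureTheory.MeasureSpace.volume; let M : ℂ → ℂ := fun s => ∫ u : ℝ, G u * Complex.exp ((s - 1 / 2) * u); -(∫ t, ‖g t‖ ^ 2) ≤ (M 0 + M 1 + ((1 / (2 * Real.pi) : ℂ) * (∫ t : ℝ, M (1 / 2 + t * Complex.I) * ((Complex.digamma (1 / 4 + t / 2 * Complex.I)).re : ℂ)) - G 0 * (Real.log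 Real.pi : ℂ)) - ∑' n : ℕ, ((((Λ n : ℝ) - if n = p then η else 0 : ℝ) : ℝ) : ℂ) / (Real.sqrt n : ℂ) * (G (Real.log n) + G (-Real.log n))).re := by
  intro g hg
  have hg' : IsWeilTest g := hg
  set N : ℝ := ∫ t : ℝ, ‖g t‖ ^ 2 with hNdef
  have hN : 0 ≤ N := integral_nonneg fun _ => by positivity
  set G : ℝ → ℂ := weilConv g (weilReflect g) with hG
  have hGc : HasCompactSupport G := (hg'.weilConv hg'.weilReflect).2
  show -N ≤ (weilPolarTerm G + weilArchTerm G -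
      ∑' n : ℕ, ((((Λ n : ℝ) - if n = p then η else 0 : ℝ) : ℝ) : ℂ) / (Real.sqrt n : ℂ) *
        (G (Real.log n) + G (-Real.log n))).re
  -- the correction term and the splitting of the fake prime sum
  set E : ℂ := ((η : ℝ) : ℂ) / (Real.sqrt p : ℂ) * (G (Real.log p) + G (-Real.log p)) with hE
  set D : ℕ → ℂ := fun n => (((if n = p then η else 0 : ℝ) : ℝ) : ℂ) / (Real.sqrt n : ℂ) *
    (G (Real.log n) + G (-Real.log n)) with hD
  have hΛ : Summable fun n : ℕ => ((Λ n : ℝ) : ℂ) / (Real.sqrt n : ℂ) * (G (Real.log n) + G (-Real.log n)) :=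
    summable_weilPrimeTerm hGc
  have hDsum : HasSum D E := by
    have h := hasSum_single (f := D) p (fun n hn => by simp [hD, hn])
    have hDp : D p = E := by simp [hD, hE]
    rwa [hDp] at h
  have hsplit : (∑' n : ℕ, ((((Λ n : ℝ) - if n = p then η else 0 : ℝ) : ℝ) : ℂ) / (Real.sqrt n : ℂ) *
        (G (Real.log n) + G (-Real.log n))) = weilPrimeTerm G - E := by
    have h1 : ∀ n : ℕ, ((((Λ n : ℝ) - if n = p then η else 0 : ℝ) : ℝ) : ℂ) / (Real.sqrt n : ℂ) *
        (G (Real.log n) + G (-Real.log n)) =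
          ((Λ n : ℝ) : ℂ) / (Real.sqrt n : ℂ) * (G (Real.log n) + G (-Real.log n)) - D n := by
      intro n
      simp only [hD]
      push_cast
      ring
    simp_rw [h1]
    rw [hΛ.tsum_sub hDsum.summable, hDsum.tsum_eq]
    rfl
  -- Weil positivity under RH and the pointwise bound `|G| ≤ ‖g‖₂²`
  have hW : 0 ≤ (weilQuadratic g).re :=
    WeilPositivity.of_riemannHypothesis explicit_formula_holds hRH g hg'
  have hQ : weilPolarTerm G + weilArchTerm G - (weilPrimeTerm G - E) = weilQuadratic g + E := by
    simp only [weilQuadratic, weilFunctional, hG]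
    ring
  have hGle : ∀ t, ‖G t‖ ≤ N := fun t => norm_weilConv_weilReflect_le hg' t
  have hcoef : ‖((η : ℝ) : ℂ) / (Real.sqrt p : ℂ)‖ = η / Real.sqrt p := by
    rw [norm_div, Complex.norm_real, Complex.norm_real, Real.norm_of_nonneg hη,
      Real.norm_of_nonneg (Real.sqrt_nonneg _)]
  have hηdiv : 0 ≤ η / Real.sqrt p := div_nonneg hη (Real.sqrt_nonneg _)
  have hratio : 2 * η / Real.sqrt p ≤ 1 := div_le_one_of_le₀ hηp (Real.sqrt_nonneg _)
  have hEn : ‖E‖ ≤ N := by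
    calc ‖E‖ = η / Real.sqrt p * ‖G (Real.log p) + G (-Real.log p)‖ := by rw [hE, norm_mul, hcoef]
      _ ≤ η / Real.sqrt p * (N + N) :=
          mul_le_mul_of_nonneg_left ((norm_add_le _ _).trans (add_le_add (hGle _) (hGle _))) hηdiv
      _ = (2 * η / Real.sqrt p) * N := by ring
      _ ≤ 1 * N := mul_le_mul_of_nonneg_right hratio hN
      _ = N := one_mul N
  have hEre : -N ≤ E.re := by
    have h := (abs_le.1 (Complex.abs_re_le_norm E)).1
    linarith
  rw [hsplit, hQ, Complex.add_re]
  linarith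

/-- **The unit-slack cone is not rigid (under RH): the prime `2` can be deleted.** The weight
`Λ 𝟙{n ≠ 2}` (`= Λ - (log 2) 𝟙{n = 2}`, vanishing AT THE PRIME `2`) is nonnegative, vanishes at `1`,
differs from `Λ`, and has unit slack against every Weil test (`2 log 2 ≤ √2`). So the natural
strengthening "a weight in the uniform unit-slack cone equals `Λ` (on prime powers)" — true for the
EXACT cone (slack `0`; 2001 W-COMP/W-SRPP, `ExactConeRigidity`) — is FALSE for the slack cone, and a
remark that unit slack pins `c(2)` to `log 2` is wrong. [folklore] -/
theorem coneMagnification_not_slackConeRigid_of_riemannHypothesis (hRH : Summit.RiemannHypothesis) :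
    ¬ (∀ c : ℕ → ℝ, (∀ n, 0 ≤ c n) → c 1 = 0 →
        (∀ g : ℝ → ℂ, (ContDiff ℝ ((⊤ : ℕ∞) : WithTop ℕ∞) g ∧ HasCompactSupport g) → let G : ℝ → ℂ := MeasureTheory.convolution g (fun u => (starRingEnd ℂ) (g (-u))) (ContinuousLinearMap.mul ℂ ℂ) MeasureTheory.MeasureSpace.volume; let M : ℂ → ℂ := fun s => ∫ u : ℝ, G u * Complex.exp ((s - 1 / 2) * u); -(∫ t, ‖g t‖ ^ 2) ≤ (M 0 + M 1 + ((1 / (2 * Real.pi) : ℂ) * (∫ t : ℝ, M (1 / 2 + t * Complex.I) * ((Complex.digamma (1 / 4 + t / 2 * Complex.I)).re : ℂ)) - G 0 * (Real.log Real.pi : ℂ)) - ∑' n : ℕ, ((c n : ℝ) : ℂ) / (Real.sqrt n : ℂ) * (G (Real.log n) + G (-Real.log n))).re) →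
        ∀ n, c n = Λ n) := by
  intro h
  have hlog2 : Real.log 2 < 0.6931471808 := Real.log_two_lt_d9
  have hlog2' : 0.6931471803 < Real.log 2 := Real.log_two_gt_d9
  have hsqrt : (1.4 : ℝ) < Real.sqrt 2 := (Real.lt_sqrt (by norm_num)).2 (by norm_num)
  have hη : 0 ≤ Real.log 2 := by linarith
  have hηp : 2 * Real.log 2 ≤ Real.sqrt (2 : ℕ) := by
    rw [Nat.cast_ofNat]
    linarith
  have hΛ2 : Λ 2 = Real.log 2 := by
    rw [ArithmeticFunction.vonMangoldt_apply_prime Nat.prime_two]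
    push_cast
    rfl
  have hc := h (fun n => (Λ n : ℝ) - if n = 2 then Real.log 2 else 0) (fun n => ?_) (by
      simp [ArithmeticFunction.vonMangoldt_apply_one]) ?_
  · have h2 := hc 2
    simp only [if_true] at h2
    linarith
  · by_cases hn : n = 2
    · subst hn
      simp [hΛ2]
    · simp [hn, ArithmeticFunction.vonMangoldt_nonneg]
  · exact coneMagnification_slackCone_sub_single_of_riemannHypothesis hRH hη hηp

/-- **The prime deficit of a cone weight reaches `1/2` (under RH).** The weight
`c = Λ - (√7/2) 𝟙{n = 7}` is nonnegative (`√7/2 < 1.33 < log 4 ≤ log 7`), vanishes at `1`, has unit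
slack against every Weil test, and its deficit is `Σₙ (Λ(n) - c(n))₊ / √n = (√7/2)/√7 = 1/2`. So the
natural strengthening "a weight in the uniform unit-slack cone has prime deficit `< 1/2`" is FALSE;
the 2001 W-MAG Thm 1.2(i) bound ("`≤ 2M`") can at best be `≥ 1/2` per unit slack, and `1/2` is what the
sup-at-`t = π/log p` (Kronecker) heuristic predicts as sharp for prime-supported deficits. [folklore] -/
theorem coneMagnification_exists_slackCone_deficit_eq_half_of_riemannHypothesis
    (hRH : Summit.RiemannHypothesis) :
    ∃ c : ℕ → ℝ, (∀ n, 0 ≤ c n) ∧ c 1 = 0 ∧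
      (∀ g : ℝ → ℂ, (ContDiff ℝ ((⊤ : ℕ∞) : WithTop ℕ∞) g ∧ HasCompactSupport g) → let G : ℝ → ℂ := MeasureTheory.convolution g (fun u => (starRingEnd ℂ) (g (-u))) (ContinuousLinearMap.mul ℂ ℂ) MeasureTheory.MeasureSpace.volume; let M : ℂ → ℂ := fun s => ∫ u : ℝ, G u * Complex.exp ((s - 1 / 2) * u); -(∫ t, ‖g t‖ ^ 2) ≤ (M 0 + M 1 + ((1 / (2 * Real.pi) : ℂ) * (∫ t : ℝ, M (1 / 2 + t * Complex.I) * ((Complex.digamma (1 / 4 + t / 2 * Complex.I)).re : ℂ)) - G 0 * (Real.log Real.pi : ℂ)) - ∑' n : ℕ, ((c n : ℝ) : ℂ) / (Real.sqrt n : ℂ) * (G (Real.log n) + G (-Real.log n))).re) ∧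
      (∑' n : ℕ, max (Λ n - c n) 0 / Real.sqrt n) = 1 / 2 := by
  set η : ℝ := Real.sqrt 7 / 2 with hηdef
  have h7pos : 0 < Real.sqrt 7 := Real.sqrt_pos.2 (by norm_num)
  have hη : 0 ≤ η := by positivity
  have hηp : 2 * η ≤ Real.sqrt (7 : ℕ) := by
    rw [Nat.cast_ofNat, hηdef]
    linarith
  -- `η < log 7`
  have hsqrt7 : Real.sqrt 7 < 2.66 := by
    rw [Real.sqrt_lt' (by norm_num)]
    norm_num
  have hlog2 : 0.6931471803 < Real.log 2 := Real.log_two_gt_d9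
  have hlog7 : 2 * Real.log 2 ≤ Real.log 7 := by
    rw [← Real.log_rpow (by norm_num), Real.log_le_log_iff (by positivity) (by norm_num)]
    norm_num
  have hηlog : η ≤ Real.log 7 := by
    rw [hηdef]
    linarith
  have hΛ7 : Λ 7 = Real.log 7 := by
    rw [ArithmeticFunction.vonMangoldt_apply_prime (by norm_num)]
    push_cast
    rfl
  refine ⟨fun n => (Λ n : ℝ) - if n = 7 then η else 0, fun n => ?_,
    by simp [ArithmeticFunction.vonMangoldt_apply_one],
    coneMagnification_slackCone_sub_single_of_riemannHypothesis hRH hη hηp, ?_⟩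
  · by_cases hn : n = 7
    · subst hn
      simp only [if_true, hΛ7]
      linarith
    · simp [hn, ArithmeticFunction.vonMangoldt_nonneg]
  · have hterm : ∀ n : ℕ, max (Λ n - ((Λ n : ℝ) - if n = 7 then η else 0)) 0 / Real.sqrt n =
        if n = 7 then η / Real.sqrt 7 else 0 := by
      intro n
      by_cases hn : n = 7
      · subst hn
        simp only [if_true, sub_sub_cancel, Nat.cast_ofNat]
        rw [max_eq_left hη]
      · simp [hn]
    simp_rw [hterm]
    rw [tsum_ite_eq, hηdef]
    field_simp

end Summit.RiemannHypothesis.RiemannHypothesis.Theorems.ConeMagnification.Negative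

end
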